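import Literature.MathematicalPhysics.QuantumFieldTheory.Balaban1983to89.T4AvgSensitivity
import Literature.MathematicalPhysics.QuantumFieldTheory.Balaban1983to89.TorusGeometry

/-!
# `T4Continuum.CovariantMeanInfluenceCount` (cell-tree module `Summits/QuantumFields/BalabanUV/T4Continuum/Support/CovariantMeanInfluenceCount.lean`)
# — road P4 of the spine estimate NE1′: leaf L4, THE COUNT — how many fine sites `n` levels down can influence a given coarse site
# through the block tower: at most `((d+1)·L^d)^n` (each coarse site is influenced by its own block and the blocks of its `d` forward
# neighbours, `T4AvgSensitivity.inflStep`, each block having `L^d` sites, `TorusGeometry`'s `Site.card_block`)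
# (cell `pub-balaban`, sub-cell `t4`, ROUND-2 prover seat #4 of BINDER-OWNERS row NE1′, unit `b2b-balaban-t4-ne1p-p4`, generation 3;
# companion of the skeleton `t4/skeletons/NE1p-t4-ne1p-p4.md` leaf L4 «COUNT» and of `Support/CovariantMeanContraction`'s letter
# `Factors.cnt·Λ₄ⁿ`; ADDITIVE — imports `…Balaban1983to89.T4AvgSensitivity` and `…TorusGeometry` only; nothing modified)

HONEST FRAMING.  Finite four-torus, rung (B)+1 only.  NOT infinite volume, NOT a mass gap, NOT the Clay problem, NOT summit progress.
HONEST DEPENDENCY: continuum YM on T⁴ ⇐ BetaPertH ∧ nine spine estimates (0/9 proved); BetaPertH ⇐ (D1) ∧ (D4) ∧ CAP+tail; G-an2-4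
gates asym, D1 and NE2/3/4.  This module is finite combinatorics on the cell's torus carrier; it asserts nothing about T. Bałaban's
densities; every declaration is [folklore] and sorry-free.  WHAT IT FIXES FOR THE ROAD: the per-level count is `Λ_d = (d+1)·L^d`
(not `L^d`): the road's per-level ratio reads `(d+1)(1+β₀)(1+η)/L < 1`, a largeness condition on `L` of the printed KIND («L a
sufficiently large integer»), number ours.

CITATION HEADER (lean-in-tree rule).  No page of the series (CMP 1983–89) or of any other source is quoted or attributed here.  Objects
re-used BY NAME: `…T4AvgSensitivity.inflStep` / `infl` (the influence sets, pv16 lineage), `…Balaban1983to89.blockOf`, `block`,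
`Site.card_block` (`TorusGeometry`), `Site.shift`.
-/

noncomputable section

open Finset

namespace Summit.QuantumFields.BalabanUV.T4Continuum.CovariantMeanInfluenceCount

open Literature.MathematicalPhysics.QuantumFieldTheory.Balaban1983to89
open Literature.MathematicalPhysics.QuantumFieldTheory.Balaban1983to89.T4AvgSensitivity (inflStep infl)

open Classical in
/-- THE ONE-STEP PREIMAGE of a coarse site `X`: the fine sites in the block of `X` or in the block of one of its `d` forward
neighbours `X + e_μ` — exactly the fine sites `y` with `X ∈ inflStep {y}`. [folklore] -/
def pre₁ {P : Params} {j : ℕ} (X : Site P (j + 1)) : Finset (Site P j) :=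
  block X ∪ Finset.univ.biUnion (fun μ : Fin P.d => block (X.shift μ))

variable {P : Params}

/-- A fine site whose block is `X` or a forward neighbour's block lies in `pre₁ X`. [folklore] -/
theorem mem_pre₁_of {j : ℕ} {X : Site P (j + 1)} {y : Site P j}
    (h : blockOf y = X ∨ ∃ μ : Fin P.d, blockOf y = X.shift μ) : y ∈ pre₁ X := by
  classical
  unfold pre₁
  rw [mem_union]
  rcases h with h | ⟨μ, hμ⟩
  · left
    simp [block, h]
  · right
    rw [mem_biUnion]
    exact ⟨μ, mem_univ μ, by simp [block, hμ]⟩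

/-- `|pre₁ X| ≤ (d+1)·L^d` (`Site.card_block`: every block has `L^d` sites; standing range `j + 1 ≤ m + K`). [folklore] -/
theorem card_pre₁_le {j : ℕ} (hj : j + 1 ≤ P.m + P.K) (X : Site P (j + 1)) :
    (pre₁ X).card ≤ (P.d + 1) * P.L ^ P.d := by
  classical
  unfold pre₁
  calc (block X ∪ Finset.univ.biUnion (fun μ : Fin P.d => block (X.shift μ))).card
      ≤ (block X).card + (Finset.univ.biUnion (fun μ : Fin P.d => block (X.shift μ))).card :=
        card_union_le _ _
    _ ≤ P.L ^ P.d + ∑ μ : Fin P.d, (block (X.shift μ)).card := by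
        refine add_le_add (by rw [Site.card_block hj]) card_biUnion_le
    _ = P.L ^ P.d + P.d * P.L ^ P.d := by
        simp [Site.card_block hj]
    _ = (P.d + 1) * P.L ^ P.d := by ring

open Classical in
/-- THE `n`-STEP PREIMAGE: the level-`k` sites `x` whose `n`-step influence set contains the level-`(k+n)` site `X`. [folklore] -/
def preN (k n : ℕ) (X : Site P (k + n)) : Finset (Site P k) :=
  Finset.univ.filter (fun x => X ∈ infl ({x} : Set (Site P k)) n)

/-- No step: only `X` itself. [folklore] -/
theorem preN_zero (k : ℕ) (X : Site P (k + 0)) : preN k 0 X = {X} := by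
  classical
  ext x
  simp only [preN, mem_filter, mem_univ, true_and, mem_singleton]
  show X ∈ ({x} : Set (Site P k)) ↔ x = X
  rw [Set.mem_singleton_iff]
  exact eq_comm

/-- One more step: the `(n+1)`-step preimage of `X` lies in the union, over the one-step preimage `y` of `X`, of the `n`-step
preimages of `y` (unfolding `infl S (n+1) = inflStep (infl S n)`). [folklore] -/
theorem preN_succ_subset (k n : ℕ) (X : Site P (k + (n + 1))) :
    preN k (n + 1) X ⊆ (pre₁ (j := k + n) X).biUnion (fun y => preN k n y) := by
  classical
  intro x hx
  simp only [preN, mem_filter, mem_univ, true_and] at hx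
  -- `X ∈ inflStep (infl {x} n)`
  obtain ⟨y, hy, hblock⟩ := hx
  rw [mem_biUnion]
  refine ⟨y, mem_pre₁_of hblock, ?_⟩
  simp only [preN, mem_filter, mem_univ, true_and]
  exact hy

/-- **THE COUNT.**  At most `((d+1)·L^d)^n` level-`k` sites can influence a given level-`(k+n)` site through `n` block-averaging
steps (standing range `k + n ≤ m + K`). [folklore] -/
theorem card_preN_le (k : ℕ) : ∀ (n : ℕ), k + n ≤ P.m + P.K → ∀ X : Site P (k + n),
    (preN k n X).card ≤ ((P.d + 1) * P.L ^ P.d) ^ n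
  | 0, _, X => by rw [preN_zero, card_singleton, pow_zero]
  | n + 1, hkn, X => by
      classical
      have hj : (k + n) + 1 ≤ P.m + P.K := by omega
      have hkn' : k + n ≤ P.m + P.K := by omega
      calc (preN k (n + 1) X).card
          ≤ ((pre₁ (j := k + n) X).biUnion (fun y => preN k n y)).card := card_le_card (preN_succ_subset k n X)
        _ ≤ ∑ y ∈ pre₁ (j := k + n) X, (preN k n y).card := card_biUnion_le
        _ ≤ ∑ _y ∈ pre₁ (j := k + n) X, ((P.d + 1) * P.L ^ P.d) ^ n :=
            sum_le_sum fun y _ => card_preN_le k n hkn' y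
        _ = (pre₁ (j := k + n) X).card * ((P.d + 1) * P.L ^ P.d) ^ n := by rw [sum_const, smul_eq_mul]
        _ ≤ ((P.d + 1) * P.L ^ P.d) * ((P.d + 1) * P.L ^ P.d) ^ n :=
            Nat.mul_le_mul_right _ (card_pre₁_le hj X)
        _ = ((P.d + 1) * P.L ^ P.d) ^ (n + 1) := by ring

/-- Real-number form for the road's `Factors.cnt·Λ_dⁿ` with `Λ_d = (d+1)·L^d`. [folklore] -/
theorem card_preN_le_real (k n : ℕ) (hkn : k + n ≤ P.m + P.K) (X : Site P (k + n)) :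
    ((preN k n X).card : ℝ) ≤ (((P.d : ℝ) + 1) * (P.L : ℝ) ^ P.d) ^ n := by
  have h := card_preN_le k n hkn X
  exact_mod_cast h

/-- The road's per-level ratio with the honest count: count `(d+1)L^d` × pushforward `L^{1−d}` × depth `(1+β₀)(1+η)L⁻²` is
`(d+1)(1+β₀)(1+η)/L`, which is `< 1` as soon as `(d+1)(1+β₀)(1+η) < L` (`L > 0`). [folklore] -/
theorem perLevel_ratio_lt_one {d : ℕ} {L β₀ η : ℝ} (hL : 0 < L)
    (h : ((d : ℝ) + 1) * (1 + β₀) * (1 + η) < L) :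
    ((d : ℝ) + 1) * L ^ d * L ^ (1 - (d : ℤ)) * ((1 + β₀) * (1 + η) * L⁻¹ ^ 2) < 1 := by
  have hL0 : L ≠ 0 := hL.ne'
  have hpow : L ^ d * L ^ (1 - (d : ℤ)) = L := by
    rw [← zpow_natCast, ← zpow_add₀ hL0]
    have : (d : ℤ) + (1 - (d : ℤ)) = 1 := by ring
    rw [this, zpow_one]
  have e : ((d : ℝ) + 1) * L ^ d * L ^ (1 - (d : ℤ)) * ((1 + β₀) * (1 + η) * L⁻¹ ^ 2)
      = ((d : ℝ) + 1) * (1 + β₀) * (1 + η) / L := by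
    have : ((d : ℝ) + 1) * L ^ d * L ^ (1 - (d : ℤ)) = ((d : ℝ) + 1) * (L ^ d * L ^ (1 - (d : ℤ))) := by ring
    rw [this, hpow]
    field_simp
  rw [e, div_lt_one hL]
  exact h

end Summit.QuantumFields.BalabanUV.T4Continuum.CovariantMeanInfluenceCount

end
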